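import Summits.NavierStokesRegularity.NavierStokesRegularity.Theses.GaldiLiouvilleGate
import Summits.NavierStokesRegularity.NavierStokesRegularity.Theorems.GaldiLiouvilleGateFrozenCoreSteadyLimit

/-!
# Route GaldiLiouvilleGate — frozen-core steady limit: every subsequential limit; isolated cores
# versus `GaldiLiouville` (item stmt-NavierStokesRegularity-0925)

Complements to `GaldiLiouvilleGateFrozenCoreSteadyLimit`.

* `frozenCoreSteadyLimit_of_tendsto`: the informal item speaks of "every `C¹_loc`-limit `U_*` of
  the core slices". A subsequence of a quasi-steady core sequence is again one
  (`frozenCore_isQuasiSteadyCoreSequence_comp`), so the steady-limit theorem applied to the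
  subsequence and uniqueness of pointwise limits show that EVERY pointwise subsequential limit `U`
  of the core slices `V_{φ j}(0, ·)` is a smooth steady Navier–Stokes flow with the same viscosity,
  `‖U 0‖ = 1`, `‖U‖ ≤ M ν`, of finite Dirichlet integral under a bounded Dirichlet share.
* `frozenCore_tendsto_cocompact_of_isolated`: decay of the limit at infinity is NOT a consequence
  of the core-window hypotheses; it holds under an explicit ISOLATION hypothesis (the velocity is
  uniformly small, in core units, far from the centre: the "matching region" of the informal item).
* `galdiLiouville_excludes_isolated_frozenCore`: the item's advertised CONSEQUENCE in typed form —
  the route decl `GaldiLiouville` (stmt-0895) excludes isolated quasi-steady cores with bounded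
  Dirichlet share (their frozen limit would be a nontrivial smooth decaying `D`-solution).
-/

noncomputable section

-- the summit-side namespace `Summit.NavierStokesRegularity.NavierStokesRegularity.…` repeats a
-- component by design (D-0017)
set_option linter.dupNamespace false

open Literature.Analysis.FluidPDE MeasureTheory Set Function Filter Topology Metric
open scoped ENNReal NNReal

namespace Summit.NavierStokesRegularity.NavierStokesRegularity.Theorems

section Every

variable {E : Type*} [NormedAddCommGroup E] [InnerProductSpace ℝ E]

/-- **Subsequences of quasi-steady core sequences are quasi-steady core sequences** (every field of
`IsQuasiSteadyCoreSequence` is a pointwise or an eventual statement in `k`). [folklore] -/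
theorem frozenCore_isQuasiSteadyCoreSequence_comp {ν T M : ℝ} {u : ℝ → E → E} {t : ℕ → ℝ}
    {ξ : ℕ → E} {lam : ℕ → ℝ} (h : IsQuasiSteadyCoreSequence ν T u t ξ lam M) {φ : ℕ → ℕ}
    (hφ : StrictMono φ) : IsQuasiSteadyCoreSequence ν T u (t ∘ φ) (ξ ∘ φ) (lam ∘ φ) M where
  time_mem k := h.time_mem (φ k)
  tendsto_time := h.tendsto_time.comp hφ.tendsto_atTop
  scale_pos k := h.scale_pos (φ k)
  tendsto_scale := h.tendsto_scale.comp hφ.tendsto_atTop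
  eventually_window A hA := hφ.tendsto_atTop.eventually (h.eventually_window A hA)
  core_bound A hA := by
    obtain ⟨C, hC⟩ := h.core_bound A hA
    exact ⟨C, hφ.tendsto_atTop.eventually hC⟩
  quasiSteady A hA ε hε := hφ.tendsto_atTop.eventually (h.quasiSteady A hA ε hε)
  scale_mul_norm_eq_one k := h.scale_mul_norm_eq_one (φ k)
  scale_mul_norm_le k x := h.scale_mul_norm_le (φ k) x

omit [InnerProductSpace ℝ E] in
/-- The Dirichlet share bound passes to subsequences. [folklore] -/
theorem frozenCore_hasBoundedDirichletShare_comp [InnerProductSpace ℝ E] [FiniteDimensional ℝ E]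
    [MeasurableSpace E] [BorelSpace E] {u : ℝ → E → E} {t : ℕ → ℝ} {lam : ℕ → ℝ}
    (hD : HasBoundedDirichletShare u t lam) (φ : ℕ → ℕ) :
    HasBoundedDirichletShare u (t ∘ φ) (lam ∘ φ) := by
  obtain ⟨D, hDk⟩ := hD
  exact ⟨D, fun k => hDk (φ k)⟩

/-- **Every subsequential limit of the core slices is a smooth steady Navier–Stokes flow** (`ℝ³`;
the "every `C¹_loc`-limit `U_*` of `U_k` is a bounded STEADY flow" clause of item stmt-0925, with
mere pointwise convergence of the slices along the subsequence as hypothesis): if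
`V_{φ j}(0, y) → U(y)` for every `y` along a strictly increasing `φ`, then `U` is `C^∞`, there is a
`C^∞` pressure `P` with `IsLerayProfile ν 0 U P`, `‖U 0‖ = 1`, `‖U‖ ≤ M ν`, and `∫ |∇U|² < ∞` under
a bounded Dirichlet share. (Apply `frozenCoreSteadyLimit` to the subsequence, itself a quasi-steady
core sequence, and identify the two limits pointwise.) [folklore] -/
theorem frozenCoreSteadyLimit_of_tendsto {ν T M : ℝ}
    {u : ℝ → EuclideanSpace ℝ (Fin 3) → EuclideanSpace ℝ (Fin 3)}
    {p : ℝ → EuclideanSpace ℝ (Fin 3) → ℝ} {t : ℕ → ℝ} {ξ : ℕ → EuclideanSpace ℝ (Fin 3)}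
    {lam : ℕ → ℝ} (hν : 0 < ν) (hu : IsClassicalNSSolutionOn (Ico 0 T) ν 0 u p)
    (h : IsQuasiSteadyCoreSequence ν T u t ξ lam M) {φ : ℕ → ℕ} (hφ : StrictMono φ)
    {U : EuclideanSpace ℝ (Fin 3) → EuclideanSpace ℝ (Fin 3)}
    (hU : ∀ y, Tendsto (fun j => coreProfile u (t (φ j)) (ξ (φ j)) (lam (φ j)) 0 y) atTop
      (𝓝 (U y))) :
    ∃ P : EuclideanSpace ℝ (Fin 3) → ℝ, IsLerayProfile ν 0 U P ∧ ContDiff ℝ (⊤ : ℕ∞) U ∧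
      ContDiff ℝ (⊤ : ℕ∞) P ∧ ‖U 0‖ = 1 ∧ (∀ y, ‖U y‖ ≤ M * ν) ∧
      (HasBoundedDirichletShare u t lam →
        ∫⁻ y, ENNReal.ofReal (frobeniusNormSq (fderiv ℝ U y)) < ⊤) := by
  obtain ⟨ψ, hψ, U', P, hprof, hUs, hPs, hU0, hUb, hc0, -, -, -, hfin⟩ :=
    frozenCoreSteadyLimit hν hu (frozenCore_isQuasiSteadyCoreSequence_comp h hφ)
  -- the two limits agree pointwise
  have hUU' : U' = U := by
    funext y
    have h1 : Tendsto (fun j => coreProfile u (t (φ (ψ j))) (ξ (φ (ψ j))) (lam (φ (ψ j))) 0 y)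
        atTop (𝓝 (U' y)) :=
      (hc0 ‖y‖).tendsto_at (mem_closedBall_zero_iff.2 le_rfl)
    exact tendsto_nhds_unique h1 ((hU y).comp hψ.tendsto_atTop)
  subst hUU'
  exact ⟨P, hprof, hUs, hPs, hU0, hUb,
    fun hD => hfin (frozenCore_hasBoundedDirichletShare_comp hD φ)⟩

end Every

section Isolated

variable {E : Type*} [NormedAddCommGroup E] [InnerProductSpace ℝ E] [FiniteDimensional ℝ E]

/-- **Isolated cores give decaying limits.** If, in core units, the velocity is uniformly small
far from the centre — for every `ε > 0` there is `A` with `λ_k ‖u(t_k, ξ_k + λ_k y)‖ ≤ ε` for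
`‖y‖ ≥ A` and all large `k` (a single-bump / "matching region" hypothesis, NOT part of
`IsQuasiSteadyCoreSequence`) — then every pointwise subsequential limit `U` of the core slices
tends to `0` at infinity (`Tendsto U (cocompact E) (𝓝 0)`, the decay hypothesis of the route decl
`GaldiLiouville`). [folklore] -/
theorem frozenCore_tendsto_cocompact_of_isolated {u : ℝ → E → E} {t : ℕ → ℝ} {ξ : ℕ → E}
    {lam : ℕ → ℝ} {φ : ℕ → ℕ} (hφ : StrictMono φ) {U : E → E} (hlam : ∀ k, 0 ≤ lam k)
    (hU : ∀ y, Tendsto (fun j => coreProfile u (t (φ j)) (ξ (φ j)) (lam (φ j)) 0 y) atTop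
      (𝓝 (U y)))
    (hfar : ∀ ε : ℝ, 0 < ε → ∃ A : ℝ, ∀ᶠ k in atTop, ∀ y : E, A ≤ ‖y‖ →
      lam k * ‖u (t k) (ξ k + lam k • y)‖ ≤ ε) :
    Tendsto U (cocompact E) (𝓝 0) := by
  rw [Metric.tendsto_nhds]
  intro ε hε
  obtain ⟨A, hA⟩ := hfar (ε / 2) (half_pos hε)
  have hAφ := hφ.tendsto_atTop.eventually hA
  have hbound : ∀ y, A ≤ ‖y‖ → ‖U y‖ ≤ ε / 2 := fun y hy => by
    refine le_of_tendsto (hU y).norm ?_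
    filter_upwards [hAφ] with j hj
    rw [norm_coreProfile_zero u _ _ (hlam _)]
    exact hj y hy
  filter_upwards [(isCompact_closedBall (0 : E) A).compl_mem_cocompact] with y hy
  rw [dist_zero_right]
  have hy' : A ≤ ‖y‖ := by
    rw [mem_compl_iff, mem_closedBall_zero_iff, not_le] at hy
    exact hy.le
  exact (hbound y hy').trans_lt (half_lt_self hε)

/-- **Galdi's Liouville theorem excludes isolated frozen cores with bounded Dirichlet share** (the
typed form of the item's CONSEQUENCE "GaldiLiouville ∧ FrozenCoreSteadyLimit ⇒ no bounded-`Re_core`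
quasi-steady Type-II core", with the matching-region decay made an explicit hypothesis): under the
route decl `GaldiLiouville`, a classical solution on `[0, T) × ℝ³` admits NO quasi-steady core
sequence which has bounded Dirichlet share and is isolated in the above sense — its frozen limit
would be a nontrivial smooth `D`-solution decaying at infinity. [folklore] -/
theorem galdiLiouville_excludes_isolated_frozenCore
    (hG :
      Summit.NavierStokesRegularity.NavierStokesRegularity.Theses.GaldiLiouvilleGate.GaldiLiouville)
    {ν T M : ℝ} {u : ℝ → EuclideanSpace ℝ (Fin 3) → EuclideanSpace ℝ (Fin 3)}
    {p : ℝ → EuclideanSpace ℝ (Fin 3) → ℝ} {t : ℕ → ℝ} {ξ : ℕ → EuclideanSpace ℝ (Fin 3)}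
    {lam : ℕ → ℝ} (hν : 0 < ν) (hu : IsClassicalNSSolutionOn (Ico 0 T) ν 0 u p)
    (h : IsQuasiSteadyCoreSequence ν T u t ξ lam M) (hD : HasBoundedDirichletShare u t lam)
    (hfar : ∀ ε : ℝ, 0 < ε → ∃ A : ℝ, ∀ᶠ k in atTop, ∀ y : EuclideanSpace ℝ (Fin 3), A ≤ ‖y‖ →
      lam k * ‖u (t k) (ξ k + lam k • y)‖ ≤ ε) :
    False := by
  obtain ⟨φ, hφ, U, P, hprof, hUs, hPs, hU0, -, hc0, -, -, -, hfin⟩ := frozenCoreSteadyLimit hν hu h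
  have hUpt : ∀ y, Tendsto (fun j => coreProfile u (t (φ j)) (ξ (φ j)) (lam (φ j)) 0 y) atTop
      (𝓝 (U y)) := fun y => (hc0 ‖y‖).tendsto_at (mem_closedBall_zero_iff.2 le_rfl)
  have hdec := frozenCore_tendsto_cocompact_of_isolated hφ (fun k => (h.scale_pos k).le) hUpt hfar
  have hzero : U = 0 := hG ν hν U P hprof hUs hPs (hfin hD) hdec
  rw [hzero, Pi.zero_apply, norm_zero] at hU0
  exact zero_ne_one hU0

end Isolated

end Summit.NavierStokesRegularity.NavierStokesRegularity.Theorems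

end
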